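import Literature.AnabelianGeometry.SemiGraphs.PSCGraphicity
import HarnessLib

/-!
# [NodNon] Lemma 1.7: an edge of the universal pro-covering abuts a vertex iff their subgroups meet (coset coordinates)

Hoshi–Mochizuki, *On the combinatorial anabelian geometry of nodally nondegenerate outer
representations*, Hiroshima Math. J. **41** (2011) 275–342 ("[NodNon]" in the IUT corpus), §1, setting
of p. 284: `Σ` a nonempty set of primes, `G` a semi-graph of anabelioids of pro-`Σ` PSC-type with
underlying semi-graph `𝔾`, `Π_G` its pro-`Σ` fundamental group, `G̃ → G` a universal pro-covering,
`Π_ṽ`, `Π_ẽ ⊆ Π_G` the verticial / edge-like subgroups of `ṽ ∈ Vert(G̃)`, `ẽ ∈ Edge(G̃)` (Def. 1.1 (vi);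
edges = nodes and cusps), `ℰ(ṽ)` the set of edges of `G̃` that abut to `ṽ`.

> **Lemma 1.7 (Intersections of verticial and edge-like subgroups).** Let `ṽ ∈ Vert(G̃)`, and
> `ẽ ∈ Edge(G̃)`. Then the following conditions are equivalent: (i) `ẽ ∈ ℰ(ṽ)`. (ii)
> `Π_ṽ ∩ Π_ẽ ≠ {1}`. In particular, if `Π_ṽ ∩ Π_ẽ ≠ {1}`, then `Π_ẽ ⊆ Π_ṽ`. (p. 290; kurims ms p. 17)

[cite: HoshiMochizukiNodNon2011, Lem 1.7 p.290] (title and wording verbatim from the kurims render p. 17, l. 2–8,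
docstring v2 after the RQ7 read of abc-iut-aud-12; cited by [IUTchI] Cor. 2.3 (vi),
proof p. 49, through "a similar argument to [CombGC] Prop. 1.5 (i), by passing to pro-`Σ` completions").

**Typing (the tree's vocabulary; STATEMENT ONLY, nothing asserted).**  As in the sibling file
`NodNonVerticialGeometry.lean` (abc-iut-w5-d042, Lemma 1.9 (ii)), a semi-graph of anabelioids of PSC-type
is recorded through abc-iut-L3's `PSCDatum P` ([CombGC] Def. 1.1 (ii)): ONE representative `Π_v`,
`Π_e` (node), `Π_c` (cusp) per component, `G.edgeGp : N ⊕ C → Subgroup Π` (`PSCGraphicity.lean`).  The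
universal pro-covering is not an object of the tree, so the lemma is stated in COSET COORDINATES
([NodNon] Rmk. 1.1.1): the pro-vertices over `v` are the `g·ṽ_v` with `Π_{g·ṽ_v} = g Π_v g⁻¹`, the
pro-edges over `e` are the `h·ẽ_e` with `Π_{h·ẽ_e} = h Π_e h⁻¹`.  Two sentences of the lemma are
expressible WITHOUT the pro-covering:

* `PSCDatum.EdgeVerticialContainment` — the "in particular" sentence, verbatim:
  `g Π_v g⁻¹ ∩ h Π_e h⁻¹ ≠ {1} ⇒ h Π_e h⁻¹ ⊆ g Π_v g⁻¹`;
* `PSCDatum.EdgeVerticialAbutment` — the shadow of (ii) ⇒ (i) on the underlying semi-graph `𝔾`: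
  `h Π_e h⁻¹ ⊆ g Π_v g⁻¹ ⇒ e abuts v in 𝔾` (a pro-edge over `e` abutting a pro-vertex over `v` projects
  to a branch of `e` at `v`; `PSCSemiGraph.Abuts`).

Their conjunction gives "`Π_ṽ ∩ Π_ẽ ≠ {1}` ⇒ `e` abuts `v`" (one line; in the proof-only companion
`NodNonEdgeVerticialIncidenceProofs.lean` together with the instances at the tree's genuine carriers).  The converse (i) ⇒ (ii) ("the edge group of an abutting edge lies in the vertex group";
for the chosen representatives this is the branch-inclusion field of `PSCDatum` up to conjugation) needs
end-point data for nodes AND cusps and is not typed here -- TODO(general form): Lemma 1.7 (i) ⇔ (ii) on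
`Vert(G̃) × Edge(G̃)` once the universal pro-covering / cusp end-point data are typed.  Both predicates
are PREDICATES ON THE DATUM (true for the `PSCDatum` of a semi-graph of anabelioids of pro-`Σ`
PSC-type; instance proofs at the tree's genuine carriers live in proof-only companions), never
asserted (over an origin parameter `Ω : PSCOrigin` a consumer writes `∀ G, Ω.IsOfPSCType G → G.…` inline,
as in `PSCGraphicity.lean`).  Consumer: the pro-`Σ̂` edge–subgraph incidence input `hF` of [IUTchI] Cor. 2.3
(vi) (`Literature/IUT/HodgeTheaters/TemperedCoveringsCor23viHatIncidenceReduction.lean`), which is this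
lemma after the generization of [CbTpI] Prop. 2.9 (i) (not typed here).  No statement of the paper is
strengthened; nothing here takes a side on [IUTchIII] Cor. 3.12.
-/

namespace Literature.AnabelianGeometry.SemiGraphs

open scoped Pointwise

universe u

/-- An edge of the underlying semi-graph *abuts* to a vertex ([NodNon] Def. 1.1 (i): "`ℰ(v)` the set
of edges of `𝔾` that abut to `v`"; [SemiAnbd] §1 p. 11): a node abuts to the two (possibly equal)
vertices of `nodeEnds`, a cusp to its `cuspEnd`. [cite: HoshiMochizukiNodNon2011, Def 1.1 (i) p.284] -/
def PSCSemiGraph.Abuts (𝔾 : PSCSemiGraph) (e : 𝔾.N ⊕ 𝔾.C) (v : 𝔾.V) : Prop :=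
  Sum.elim (fun n => v ∈ 𝔾.nodeEnds n) (fun c => 𝔾.cuspEnd c = v) e

namespace PSCDatum

variable {P : Type u} [Group P] [TopologicalSpace P] (G : PSCDatum P)

/-- **[NodNon] Lemma 1.7, "in particular" clause, in coset coordinates**: for every vertex `v`, edge
`e` (node or cusp) and `g, h ∈ Π_G` — "if `Π_ṽ ∩ Π_ẽ ≠ {1}`, then `Π_ẽ ⊆ Π_ṽ`" for the pro-vertex
`ṽ = g·ṽ_v` (`Π_ṽ = g Π_v g⁻¹`) and the pro-edge `ẽ = h·ẽ_e` (`Π_ẽ = h Π_e h⁻¹`).  A predicate on the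
datum; not asserted. [cite: HoshiMochizukiNodNon2011, Lem 1.7 p.290] -/
def EdgeVerticialContainment : Prop :=
  ∀ (v : G.graph.V) (e : G.graph.N ⊕ G.graph.C) (g h : P),
    MulAut.conj g • G.vertGp v ⊓ MulAut.conj h • G.edgeGp e ≠ ⊥ →
      MulAut.conj h • G.edgeGp e ≤ MulAut.conj g • G.vertGp v

/-- **[NodNon] Lemma 1.7 (ii) ⇒ (i), read on the underlying semi-graph**: if the edge-like subgroup of a
pro-edge over `e` is contained in the verticial subgroup of a pro-vertex over `v`
(`h Π_e h⁻¹ ⊆ g Π_v g⁻¹`), then `e` abuts to `v` in `𝔾` (the image in `𝔾` of "`ẽ ∈ ℰ(ṽ)`").  A predicate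
on the datum; not asserted. [cite: HoshiMochizukiNodNon2011, Lem 1.7 p.290] -/
def EdgeVerticialAbutment : Prop :=
  ∀ (v : G.graph.V) (e : G.graph.N ⊕ G.graph.C) (g h : P),
    MulAut.conj h • G.edgeGp e ≤ MulAut.conj g • G.vertGp v → G.graph.Abuts e v

end PSCDatum

end Literature.AnabelianGeometry.SemiGraphs
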